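import Summits.QuantumFields.BalabanUV.Beta.GAN24.BorderedFrameInverseBlocks

/-!
# `BalabanUV.Beta.GAN24.ArrowNorms` — binder row G-an2-4 / (CONV-C), road P1-fibre, row **P1-L10** `FibreStrip` ((I3′)), cut «(M4) scaled alias-space
# Neumann, two anchors» (`HOME/b2b-balaban-gan24-formalise-leaf-16/L10-CUT-M4.md`), module **F1b**: Euclidean operator-norm bookkeeping for
# ARROW-SHAPED matrices `fromBlocks (blockDiagonal T) U V 0` — structured norm bound, a-priori bound ⇒ invertibility with inverse bound, the
# perturbation (Neumann) step, and the BORDERED ANCHOR (invertible blocks + invertible reduced border system ⇒ explicit inverse bound)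

NOT IN PRINT; OUR PROOF ATTEMPT (of the road; THIS file is [folklore] finite-dimensional linear algebra over Mathlib and E1 `BorderedFrameInverse(+Blocks)` only).
HONEST FRAMING (cell contract, verbatim): «discharging `BetaPertH` makes Bałaban's UV stability UNCONDITIONAL — a real constructive-QFT result;
it is NOT the continuum limit and NOT the Clay problem.»  HONEST DEPENDENCY (verbatim): «continuum YM on T⁴ ⇐ BetaPertH ∧ nine spine estimates
(0/9 proved); BetaPertH ⇐ (D1) ∧ (D4) ∧ CAP+tail; G-an2-4 gates asym, D1 and NE2/3/4.»  No cited fact, no wall binder, no `def … : Prop` hypothesis;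
nothing of the K-slot of (CONV-C) is discharged here.  NOT summit progress.

## Contents (index types: block label `o`, slot type `l`, border type `b`; scalars `ℂ`; `‖·‖` = Mathlib's scoped `Matrix.Norms.L2Operator` norm)
§1 `l2_opNorm_le_of_forall` (bound principle), `norm_toLp_le_of_sq_le`; `norm_sq_toLp_prod` (`‖x‖² = Σ_k ‖x(·,k)‖²`);
   **`norm_blockDiagonal_le`**: `(∀ k, ‖T k‖ ≤ t) → ‖blockDiagonal T‖ ≤ t`; `blockDiagonal_inv_mul`/`isUnit_blockDiagonal` (blockwise inverse).
§2 SLOT-DIAGONAL BORDERS (the shape of the arrow system's (φ, c) columns and (Q, M) rows): `colBorder f : Matrix (l × o) l`, `(i, s) ↦ if i.1 = s then f i.2 s`,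
   `rowBorder g : Matrix l (l × o)`; `mulVec` formulas; FROBENIUS BOUNDS `‖colBorder f‖ ≤ √(Σ_k Σ_s ‖f k s‖²)`, `‖rowBorder g‖ ≤ √(Σ_k Σ_s ‖g k s‖²)`.
§3 `norm_arrow_le`: `‖fromBlocks (blockDiagonal T) U V 0‖ ≤ t + ‖U‖ + ‖V‖`;  **`isUnit_and_norm_inv_le_of_apriori`**: `(∀ x, ‖x‖ ≤ K‖A x‖) → IsUnit A ∧ ‖A⁻¹‖ ≤ K`;
   **`perturb`**: `IsUnit A → ‖A⁻¹‖ ≤ C → ‖B − A‖·C ≤ 1/2 → IsUnit B ∧ ‖B⁻¹‖ ≤ 2C` (E1 `neumann`).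
§4 **THE BORDERED ANCHOR** `apriori_bordered`: if every block `T k` is invertible with `‖(T k)⁻¹‖ ≤ t`, `‖U‖ ≤ u`, `‖V‖ ≤ v`, and the REDUCED BORDER SYSTEM
   `capS T U V := V * blockDiagonal (fun k => (T k)⁻¹) * U` is invertible with `‖(capS …)⁻¹‖ ≤ b`, then `‖x‖ ≤ (t + (t·u + 1)·b·(v·t + 1))·‖fromBlocks (blockDiagonal T) U V 0 x‖`
   for all `x`, hence `IsUnit` with that inverse bound (`isUnit_bordered`).  (At the real anchor of the cut, `capS` of the alias arrow data is the scaled CAPACITANCE of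
   leaf-15/leaf-06 — row F5 identifies it; at `p = 0` the decoupled anchor is row F3.)
-/

noncomputable section

open Matrix WithLp Complex Finset
open scoped Matrix.Norms.L2Operator InnerProductSpace BigOperators
open Summit.QuantumFields.BalabanUV.Beta.GAN24.BorderedFrameInverse (neumann isUnit_of_mulVec_eq_zero eq_zero_of_norm_toLp_le)
open Summit.QuantumFields.BalabanUV.Beta.GAN24.BorderedFrameInverseBlocks (norm_fromBlocks_le norm_sq_toLp_sumElim norm_toLp_le_inl norm_toLp_le_inr
  norm_toLp_sumElim_le)

namespace Summit.QuantumFields.BalabanUV.Beta.GAN24.ArrowNorms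

/-! ## §1 Bound principle, product index, block-diagonal matrices -/

/-- [folklore] THE BOUND PRINCIPLE for the Euclidean operator norm (Mathlib's `l2_opNorm_def` + `opNorm_le_bound`). -/
theorem l2_opNorm_le_of_forall {m o : Type*} [Fintype m] [Fintype o] [DecidableEq o] (A : Matrix m o ℂ) {C : ℝ} (hC : 0 ≤ C)
    (h : ∀ x : EuclideanSpace ℂ o, ‖(toLp 2 (A *ᵥ ofLp x) : EuclideanSpace ℂ m)‖ ≤ C * ‖x‖) : ‖A‖ ≤ C := by
  rw [Matrix.l2_opNorm_def]
  exact ContinuousLinearMap.opNorm_le_bound _ hC fun x => h x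

/-- [folklore] `‖v‖ ≤ c` from `‖v‖² ≤ c²` and `0 ≤ c`. -/
theorem norm_le_of_sq_le {E : Type*} [SeminormedAddCommGroup E] (v : E) {c : ℝ} (hc : 0 ≤ c) (h : ‖v‖ ^ 2 ≤ c ^ 2) : ‖v‖ ≤ c :=
  (pow_le_pow_iff_left₀ (norm_nonneg v) hc two_ne_zero).1 h

/-- [folklore] `‖x‖² = Σ_k ‖x(·, k)‖²` on the product index `l × o`. -/
theorem norm_sq_toLp_prod {o l : Type*} [Fintype o] [Fintype l] (x : l × o → ℂ) :
    ‖(toLp 2 x : EuclideanSpace ℂ (l × o))‖ ^ 2 = ∑ k, ‖(toLp 2 (fun s => x (s, k)) : EuclideanSpace ℂ l)‖ ^ 2 := by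
  rw [EuclideanSpace.norm_sq_eq, Fintype.sum_prod_type, Finset.sum_comm]
  exact Finset.sum_congr rfl fun k _ => by rw [EuclideanSpace.norm_sq_eq]

/-- [folklore] `blockDiagonal T` acts block by block. -/
theorem blockDiagonal_mulVec_apply {o l : Type*} [Fintype o] [DecidableEq o] [Fintype l] (T : o → Matrix l l ℂ) (x : l × o → ℂ) (s : l) (k : o) :
    (blockDiagonal T *ᵥ x) (s, k) = (T k *ᵥ fun s' => x (s', k)) s := by
  simp only [mulVec, dotProduct, Fintype.sum_prod_type, blockDiagonal_apply', ite_mul, zero_mul, Finset.sum_ite_eq,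
    Finset.mem_univ, if_true]

/-- [folklore] **BLOCK-DIAGONAL NORM**: `‖blockDiagonal T‖ ≤ t` if every block has `‖T k‖ ≤ t` (`t ≥ 0`). -/
theorem norm_blockDiagonal_le {o l : Type*} [Fintype o] [DecidableEq o] [Fintype l] [DecidableEq l] (T : o → Matrix l l ℂ) {t : ℝ} (ht : 0 ≤ t) (h : ∀ k, ‖T k‖ ≤ t) : ‖blockDiagonal T‖ ≤ t := by
  refine l2_opNorm_le_of_forall _ ht fun x => norm_le_of_sq_le _ (mul_nonneg ht (norm_nonneg _)) ?_
  rw [norm_sq_toLp_prod, mul_pow]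
  have hx : ‖x‖ ^ 2 = ∑ k, ‖(toLp 2 (fun s => ofLp x (s, k)) : EuclideanSpace ℂ l)‖ ^ 2 := by
    rw [← norm_sq_toLp_prod (ofLp x), toLp_ofLp]
  rw [hx, Finset.mul_sum]
  refine Finset.sum_le_sum fun k _ => ?_
  have e : (fun s => (blockDiagonal T *ᵥ ofLp x) (s, k)) = T k *ᵥ ofLp (toLp 2 (fun s' => ofLp x (s', k)) : EuclideanSpace ℂ l) := by
    funext s; rw [blockDiagonal_mulVec_apply]
  rw [e, ← mul_pow]
  have h1 := Matrix.l2_opNorm_mulVec (T k) (toLp 2 (fun s' => ofLp x (s', k)) : EuclideanSpace ℂ l)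
  exact pow_le_pow_left₀ (norm_nonneg _) (h1.trans (mul_le_mul_of_nonneg_right (h k) (norm_nonneg _))) 2

/-- [folklore] Blockwise inverse: `blockDiagonal (T⁻¹) * blockDiagonal T = 1` when every block is invertible. -/
theorem blockDiagonal_inv_mul {o l : Type*} [Fintype o] [DecidableEq o] [Fintype l] [DecidableEq l] (T : o → Matrix l l ℂ)
    (hT : ∀ k, IsUnit (T k)) : blockDiagonal (fun k => (T k)⁻¹) * blockDiagonal T = 1 := by
  have h : (fun k => (T k)⁻¹ * T k) = 1 := funext fun k => nonsing_inv_mul _ ((isUnit_iff_isUnit_det _).1 (hT k))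
  rw [← blockDiagonal_mul, h, blockDiagonal_one]

/-- [folklore] … and `blockDiagonal T * blockDiagonal (T⁻¹) = 1`. -/
theorem blockDiagonal_mul_inv {o l : Type*} [Fintype o] [DecidableEq o] [Fintype l] [DecidableEq l] (T : o → Matrix l l ℂ)
    (hT : ∀ k, IsUnit (T k)) : blockDiagonal T * blockDiagonal (fun k => (T k)⁻¹) = 1 := by
  have h : (fun k => T k * (T k)⁻¹) = 1 := funext fun k => mul_nonsing_inv _ ((isUnit_iff_isUnit_det _).1 (hT k))
  rw [← blockDiagonal_mul, h, blockDiagonal_one]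

/-! ## §2 Slot-diagonal borders and their Frobenius bounds -/

/-- [folklore] A SLOT-DIAGONAL COLUMN BORDER: border unknown `s` feeds local row `(s, k)` with weight `f k s` (the arrow system's `(φ, c)` columns, up to sign). -/
def colBorder {o l : Type*} [DecidableEq l] (f : o → l → ℂ) : Matrix (l × o) l ℂ := of fun i s => if i.1 = s then f i.2 s else 0

/-- [folklore] A SLOT-DIAGONAL ROW BORDER: border row `s` reads local unknown `(s, k)` with weight `g k s` (the arrow system's `(Q, M)` rows). -/
def rowBorder {o l : Type*} [DecidableEq l] (g : o → l → ℂ) : Matrix l (l × o) ℂ := of fun s i => if s = i.1 then g i.2 s else 0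

/-- [folklore] `(colBorder f x)(s, k) = f k s · x s`. -/
theorem colBorder_mulVec {o l : Type*} [Fintype l] [DecidableEq l] (f : o → l → ℂ) (x : l → ℂ) (s : l) (k : o) : (colBorder f *ᵥ x) (s, k) = f k s * x s := by
  simp only [colBorder, mulVec, dotProduct, of_apply, ite_mul, zero_mul, Finset.sum_ite_eq, Finset.mem_univ, if_true]

/-- [folklore] `(rowBorder g x)(s) = Σ_k g k s · x (s, k)`. -/
theorem rowBorder_mulVec {o l : Type*} [Fintype o] [Fintype l] [DecidableEq l] (g : o → l → ℂ) (x : l × o → ℂ) (s : l) : (rowBorder g *ᵥ x) s = ∑ k, g k s * x (s, k) := by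
  simp only [rowBorder, mulVec, dotProduct, of_apply, ite_mul, zero_mul]
  rw [Fintype.sum_prod_type, Finset.sum_comm]
  simp only [Finset.sum_ite_eq, Finset.mem_univ, if_true]

/-- [folklore] **FROBENIUS BOUND FOR THE COLUMN BORDER**: `‖colBorder f‖ ≤ √(Σ_k Σ_s ‖f k s‖²)`. -/
theorem norm_colBorder_le {o l : Type*} [Fintype o] [Fintype l] [DecidableEq l] (f : o → l → ℂ) : ‖colBorder f‖ ≤ Real.sqrt (∑ k, ∑ s, ‖f k s‖ ^ 2) := by
  refine l2_opNorm_le_of_forall _ (Real.sqrt_nonneg _) fun x => norm_le_of_sq_le _ (mul_nonneg (Real.sqrt_nonneg _) (norm_nonneg _)) ?_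
  have hF : 0 ≤ ∑ k, ∑ s, ‖f k s‖ ^ 2 := Finset.sum_nonneg fun k _ => Finset.sum_nonneg fun s _ => sq_nonneg _
  rw [mul_pow, Real.sq_sqrt hF, norm_sq_toLp_prod]
  have hxs : ∀ s, ‖ofLp x s‖ ^ 2 ≤ ‖x‖ ^ 2 := fun s => by
    rw [EuclideanSpace.norm_sq_eq]
    exact Finset.single_le_sum (fun i _ => sq_nonneg ‖ofLp x i‖) (Finset.mem_univ s)
  rw [Finset.sum_mul]
  refine Finset.sum_le_sum fun k _ => ?_
  rw [EuclideanSpace.norm_sq_eq, Finset.sum_mul]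
  refine Finset.sum_le_sum fun s _ => ?_
  have e : (toLp 2 fun s => (colBorder f *ᵥ ofLp x) (s, k) : EuclideanSpace ℂ l) s = f k s * ofLp x s := by
    simp only [colBorder_mulVec]
  rw [e, norm_mul, mul_pow]
  exact mul_le_mul_of_nonneg_left (hxs s) (sq_nonneg _)

/-- [folklore] **FROBENIUS BOUND FOR THE ROW BORDER**: `‖rowBorder g‖ ≤ √(Σ_k Σ_s ‖g k s‖²)` (Cauchy–Schwarz in the alias index). -/
theorem norm_rowBorder_le {o l : Type*} [Fintype o] [DecidableEq o] [Fintype l] [DecidableEq l] (g : o → l → ℂ) : ‖rowBorder g‖ ≤ Real.sqrt (∑ k, ∑ s, ‖g k s‖ ^ 2) := by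
  refine l2_opNorm_le_of_forall _ (Real.sqrt_nonneg _) fun x => norm_le_of_sq_le _ (mul_nonneg (Real.sqrt_nonneg _) (norm_nonneg _)) ?_
  have hF : 0 ≤ ∑ k, ∑ s, ‖g k s‖ ^ 2 := Finset.sum_nonneg fun k _ => Finset.sum_nonneg fun s _ => sq_nonneg _
  rw [mul_pow, Real.sq_sqrt hF, EuclideanSpace.norm_sq_eq]
  have hx : ‖x‖ ^ 2 = ∑ s, ∑ k, ‖ofLp x (s, k)‖ ^ 2 := by
    rw [EuclideanSpace.norm_sq_eq, Fintype.sum_prod_type]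
  -- per border row `s`: Cauchy–Schwarz over `k`
  have hrow : ∀ s, ‖(toLp 2 (rowBorder g *ᵥ ofLp x) : EuclideanSpace ℂ l) s‖ ^ 2 ≤ (∑ k, ‖g k s‖ ^ 2) * ∑ k, ‖ofLp x (s, k)‖ ^ 2 := fun s => by
    have e : (toLp 2 (rowBorder g *ᵥ ofLp x) : EuclideanSpace ℂ l) s = ∑ k, g k s * ofLp x (s, k) := by
      simp only [rowBorder_mulVec]
    rw [e]
    calc ‖∑ k, g k s * ofLp x (s, k)‖ ^ 2 ≤ (∑ k, ‖g k s‖ * ‖ofLp x (s, k)‖) ^ 2 := by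
          gcongr; exact (norm_sum_le _ _).trans (le_of_eq (Finset.sum_congr rfl fun k _ => norm_mul _ _))
      _ ≤ (∑ k, ‖g k s‖ ^ 2) * ∑ k, ‖ofLp x (s, k)‖ ^ 2 :=
          Finset.sum_mul_sq_le_sq_mul_sq _ _ _
  calc ∑ s, ‖(toLp 2 (rowBorder g *ᵥ ofLp x) : EuclideanSpace ℂ l) s‖ ^ 2
      ≤ ∑ s, (∑ k, ‖g k s‖ ^ 2) * ∑ k, ‖ofLp x (s, k)‖ ^ 2 := Finset.sum_le_sum fun s _ => hrow s
    _ ≤ ∑ s, (∑ k, ∑ s', ‖g k s'‖ ^ 2) * ∑ k, ‖ofLp x (s, k)‖ ^ 2 := by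
        refine Finset.sum_le_sum fun s _ => mul_le_mul_of_nonneg_right ?_ (Finset.sum_nonneg fun k _ => sq_nonneg _)
        exact Finset.sum_le_sum fun k _ => Finset.single_le_sum (fun s' _ => sq_nonneg ‖g k s'‖) (Finset.mem_univ s)
    _ = (∑ k, ∑ s, ‖g k s‖ ^ 2) * ‖x‖ ^ 2 := by
        rw [← Finset.mul_sum, hx]

/-! ## §3 Structured norm bound, a-priori bound ⇒ invertibility, perturbation -/

/-- [folklore] **STRUCTURED NORM BOUND** for an arrow-shaped matrix: `‖[[blockDiagonal T, U],[V, 0]]‖ ≤ t + ‖U‖ + ‖V‖` when every block has `‖T k‖ ≤ t`. -/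
theorem norm_arrow_le {o l b : Type*} [Fintype o] [DecidableEq o] [Fintype l] [DecidableEq l] [Fintype b] [DecidableEq b]
    (T : o → Matrix l l ℂ) (U : Matrix (l × o) b ℂ) (V : Matrix b (l × o) ℂ) {t : ℝ} (ht : 0 ≤ t)
    (h : ∀ k, ‖T k‖ ≤ t) : ‖fromBlocks (blockDiagonal T) U V (0 : Matrix b b ℂ)‖ ≤ t + ‖U‖ + ‖V‖ := by
  have h0 : ‖(0 : Matrix b b ℂ)‖ = 0 := norm_zero
  calc ‖fromBlocks (blockDiagonal T) U V (0 : Matrix b b ℂ)‖ ≤ ‖blockDiagonal T‖ + ‖U‖ + ‖V‖ + ‖(0 : Matrix b b ℂ)‖ :=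
        norm_fromBlocks_le _ _ _ _
    _ ≤ t + ‖U‖ + ‖V‖ := by rw [h0, add_zero]; gcongr; exact norm_blockDiagonal_le T ht h

/-- [folklore] **A-PRIORI BOUND ⇒ INVERTIBILITY WITH INVERSE BOUND**: if `‖x‖ ≤ K·‖A x‖` for all `x` (Euclidean norms) then `A` is invertible and `‖A⁻¹‖ ≤ K`. -/
theorem isUnit_and_norm_inv_le_of_apriori {n : Type*} [Fintype n] [DecidableEq n] {A : Matrix n n ℂ} {K : ℝ} (hK : 0 ≤ K)
    (h : ∀ x : n → ℂ, ‖(toLp 2 x : EuclideanSpace ℂ n)‖ ≤ K * ‖(toLp 2 (A *ᵥ x) : EuclideanSpace ℂ n)‖) :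
    IsUnit A ∧ ‖A⁻¹‖ ≤ K := by
  have hU : IsUnit A := by
    refine isUnit_of_mulVec_eq_zero fun x hx => ?_
    have h1 := h x
    rw [hx, toLp_zero, norm_zero, mul_zero] at h1
    have : (toLp 2 x : EuclideanSpace ℂ n) = 0 := norm_le_zero_iff.1 h1
    simpa using congrArg ofLp this
  refine ⟨hU, l2_opNorm_le_of_forall _ hK fun y => ?_⟩
  have hdet : IsUnit A.det := (isUnit_iff_isUnit_det _).1 hU
  have h1 := h (A⁻¹ *ᵥ ofLp y)
  rwa [mulVec_mulVec, mul_nonsing_inv _ hdet, one_mulVec, toLp_ofLp] at h1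

/-- [folklore] **PERTURBATION STEP** (E1 `neumann` repackaged for an anchor `A` and a nearby `B`): `IsUnit A`, `‖A⁻¹‖ ≤ C`, `‖B − A‖·C ≤ 1/2` ⇒ `IsUnit B`, `‖B⁻¹‖ ≤ 2C`. -/
theorem perturb {n : Type*} [Fintype n] [DecidableEq n] {A B : Matrix n n ℂ} {C : ℝ} (hA : IsUnit A) (hC : ‖A⁻¹‖ ≤ C)
    (h : ‖B - A‖ * C ≤ 1 / 2) : IsUnit B ∧ ‖B⁻¹‖ ≤ 2 * C := by
  have hE : ‖B - A‖ * ‖A⁻¹‖ ≤ 1 / 2 := (mul_le_mul_of_nonneg_left hC (norm_nonneg _)).trans h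
  obtain ⟨hU, hR, -⟩ := neumann (C₀ := A) (E := B - A) hA hE
  rw [add_sub_cancel] at hU hR
  exact ⟨hU, hR.trans (by linarith)⟩

/-! ## §4 The bordered anchor: invertible blocks + invertible reduced border system -/

/-- [folklore] THE REDUCED BORDER SYSTEM («scaled capacitance» of the cut): `capS T U V = V · blockDiagonal (T⁻¹) · U`. -/
def capS {o l b : Type*} [Fintype o] [DecidableEq o] [Fintype l] [DecidableEq l] (T : o → Matrix l l ℂ) (U : Matrix (l × o) b ℂ)
    (V : Matrix b (l × o) ℂ) : Matrix b b ℂ :=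
  V * blockDiagonal (fun k => (T k)⁻¹) * U

/-- [folklore] `‖M w‖ ≤ ‖M‖·‖w‖` for plain vectors read in `EuclideanSpace`. -/
theorem norm_toLp_mulVec_le {m' n' : Type*} [Fintype m'] [Fintype n'] [DecidableEq n'] (M : Matrix m' n' ℂ) (w : n' → ℂ) :
    ‖(toLp 2 (M *ᵥ w) : EuclideanSpace ℂ m')‖ ≤ ‖M‖ * ‖(toLp 2 w : EuclideanSpace ℂ n')‖ := by
  simpa using Matrix.l2_opNorm_mulVec M (toLp 2 w)

/-- [folklore] ELIMINATION IDENTITIES of an arrow-shaped system with invertible blocks: writing `y = [[blockDiagonal T, U],[V, 0]] (xl, xb)`,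
`xl = T⁻¹ y_loc − T⁻¹ U xb` and `capS · xb = V T⁻¹ y_loc − y_bor`. -/
theorem elim_identities {o l b : Type*} [Fintype o] [DecidableEq o] [Fintype l] [DecidableEq l] [Fintype b] [DecidableEq b]
    (T : o → Matrix l l ℂ) (U : Matrix (l × o) b ℂ) (V : Matrix b (l × o) ℂ) (hT : ∀ k, IsUnit (T k)) (xl : l × o → ℂ) (xb : b → ℂ) :
    xl = blockDiagonal (fun k => (T k)⁻¹) *ᵥ (blockDiagonal T *ᵥ xl + U *ᵥ xb) - blockDiagonal (fun k => (T k)⁻¹) *ᵥ (U *ᵥ xb) ∧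
    capS T U V *ᵥ xb = V *ᵥ (blockDiagonal (fun k => (T k)⁻¹) *ᵥ (blockDiagonal T *ᵥ xl + U *ᵥ xb)) - V *ᵥ xl := by
  have hTiT := blockDiagonal_inv_mul T hT
  have h1 : xl = blockDiagonal (fun k => (T k)⁻¹) *ᵥ (blockDiagonal T *ᵥ xl + U *ᵥ xb) - blockDiagonal (fun k => (T k)⁻¹) *ᵥ (U *ᵥ xb) := by
    rw [mulVec_add, mulVec_mulVec, hTiT, one_mulVec, add_sub_cancel_right]
  refine ⟨h1, ?_⟩
  rw [capS, ← mulVec_mulVec, ← mulVec_mulVec, ← mulVec_sub]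
  congr 1
  rw [mulVec_add, mulVec_mulVec, mulVec_mulVec, hTiT, one_mulVec, add_sub_cancel_left]

/-- [folklore] **THE BORDERED A-PRIORI BOUND.**  Blocks invertible with `‖(T k)⁻¹‖ ≤ t`, borders `‖U‖ ≤ u`, `‖V‖ ≤ v`, reduced system invertible with `‖(capS T U V)⁻¹‖ ≤ b`
⇒ `‖(xl, xb)‖ ≤ (t + (t·u + 1)·b·(v·t + 1)) · ‖[[blockDiagonal T, U],[V, 0]] (xl, xb)‖` (solve the local rows for the local unknowns, substitute into the border rows). -/
theorem apriori_bordered {o l b : Type*} [Fintype o] [DecidableEq o] [Fintype l] [DecidableEq l] [Fintype b] [DecidableEq b]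
    (T : o → Matrix l l ℂ) (U : Matrix (l × o) b ℂ) (V : Matrix b (l × o) ℂ) {t u v bb : ℝ}
    (hT : ∀ k, IsUnit (T k)) (ht : ∀ k, ‖(T k)⁻¹‖ ≤ t) (ht0 : 0 ≤ t) (hu : ‖U‖ ≤ u) (hv : ‖V‖ ≤ v)
    (hS : IsUnit (capS T U V)) (hb : ‖(capS T U V)⁻¹‖ ≤ bb) (xl : l × o → ℂ) (xb : b → ℂ) :
    ‖(toLp 2 (Sum.elim xl xb) : EuclideanSpace ℂ ((l × o) ⊕ b))‖ ≤
      (t + (t * u + 1) * bb * (v * t + 1)) *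
        ‖(toLp 2 (fromBlocks (blockDiagonal T) U V 0 *ᵥ Sum.elim xl xb) : EuclideanSpace ℂ ((l × o) ⊕ b))‖ := by
  obtain ⟨hxl, hcap⟩ := elim_identities T U V hT xl xb
  -- the two halves of y
  set yl : l × o → ℂ := blockDiagonal T *ᵥ xl + U *ᵥ xb with hyl
  set yb : b → ℂ := V *ᵥ xl with hyb
  have hy : fromBlocks (blockDiagonal T) U V 0 *ᵥ Sum.elim xl xb = Sum.elim yl yb := by
    rw [fromBlocks_mulVec, Sum.elim_comp_inl, Sum.elim_comp_inr, zero_mulVec, add_zero]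
  rw [hy]
  set Y : ℝ := ‖(toLp 2 (Sum.elim yl yb) : EuclideanSpace ℂ ((l × o) ⊕ b))‖ with hY
  have hyl_le : ‖(toLp 2 yl : EuclideanSpace ℂ (l × o))‖ ≤ Y := norm_toLp_le_inl yl yb
  have hyb_le : ‖(toLp 2 yb : EuclideanSpace ℂ b)‖ ≤ Y := norm_toLp_le_inr yl yb
  have hdetS : IsUnit (capS T U V).det := (isUnit_iff_isUnit_det _).1 hS
  have hxb : xb = (capS T U V)⁻¹ *ᵥ (V *ᵥ (blockDiagonal (fun k => (T k)⁻¹) *ᵥ yl) - yb) := by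
    rw [← hcap, mulVec_mulVec, nonsing_inv_mul _ hdetS, one_mulVec]
  have hTi : ‖blockDiagonal (fun k => (T k)⁻¹)‖ ≤ t := norm_blockDiagonal_le _ ht0 ht
  have hu0 : 0 ≤ u := (norm_nonneg _).trans hu
  have hv0 : 0 ≤ v := (norm_nonneg _).trans hv
  have hb0 : 0 ≤ bb := (norm_nonneg _).trans hb
  have hY0 : 0 ≤ Y := norm_nonneg _
  -- ‖T⁻¹ yl‖ ≤ t Y
  have h1 : ‖(toLp 2 (blockDiagonal (fun k => (T k)⁻¹) *ᵥ yl) : EuclideanSpace ℂ (l × o))‖ ≤ t * Y :=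
    (norm_toLp_mulVec_le _ _).trans (mul_le_mul hTi hyl_le (norm_nonneg _) ht0)
  -- ‖V T⁻¹ yl − yb‖ ≤ (v t + 1) Y
  have h2 : ‖(toLp 2 (V *ᵥ (blockDiagonal (fun k => (T k)⁻¹) *ᵥ yl) - yb) : EuclideanSpace ℂ b)‖ ≤ (v * t + 1) * Y := by
    rw [toLp_sub]
    refine (norm_sub_le _ _).trans ?_
    have h21 : ‖(toLp 2 (V *ᵥ (blockDiagonal (fun k => (T k)⁻¹) *ᵥ yl)) : EuclideanSpace ℂ b)‖ ≤ v * (t * Y) :=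
      (norm_toLp_mulVec_le _ _).trans (mul_le_mul hv h1 (norm_nonneg _) hv0)
    nlinarith
  -- ‖xb‖ ≤ bb (v t + 1) Y
  have h3 : ‖(toLp 2 xb : EuclideanSpace ℂ b)‖ ≤ bb * ((v * t + 1) * Y) := by
    rw [hxb]
    exact (norm_toLp_mulVec_le _ _).trans (mul_le_mul hb h2 (norm_nonneg _) hb0)
  -- ‖xl‖ ≤ t Y + t u ‖xb‖
  have h4 : ‖(toLp 2 xl : EuclideanSpace ℂ (l × o))‖ ≤ t * Y + t * u * (bb * ((v * t + 1) * Y)) := by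
    rw [hxl, toLp_sub]
    refine (norm_sub_le _ _).trans (add_le_add h1 ?_)
    have h41 : ‖(toLp 2 (U *ᵥ xb) : EuclideanSpace ℂ (l × o))‖ ≤ u * (bb * ((v * t + 1) * Y)) :=
      (norm_toLp_mulVec_le _ _).trans (mul_le_mul hu h3 (norm_nonneg _) hu0)
    calc ‖(toLp 2 (blockDiagonal (fun k => (T k)⁻¹) *ᵥ (U *ᵥ xb)) : EuclideanSpace ℂ (l × o))‖
        ≤ ‖blockDiagonal (fun k => (T k)⁻¹)‖ * ‖(toLp 2 (U *ᵥ xb) : EuclideanSpace ℂ (l × o))‖ := norm_toLp_mulVec_le _ _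
      _ ≤ t * (u * (bb * ((v * t + 1) * Y))) := mul_le_mul hTi h41 (norm_nonneg _) ht0
      _ = t * u * (bb * ((v * t + 1) * Y)) := by ring
  calc ‖(toLp 2 (Sum.elim xl xb) : EuclideanSpace ℂ ((l × o) ⊕ b))‖
      ≤ ‖(toLp 2 xl : EuclideanSpace ℂ (l × o))‖ + ‖(toLp 2 xb : EuclideanSpace ℂ b)‖ := norm_toLp_sumElim_le _ _
    _ ≤ (t * Y + t * u * (bb * ((v * t + 1) * Y))) + bb * ((v * t + 1) * Y) := add_le_add h4 h3
    _ = (t + (t * u + 1) * bb * (v * t + 1)) * Y := by ring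

/-- [folklore] **THE BORDERED ANCHOR**: under the hypotheses of `apriori_bordered`, `[[blockDiagonal T, U],[V, 0]]` is invertible with
`‖inverse‖ ≤ t + (t·u + 1)·b·(v·t + 1)`. -/
theorem isUnit_bordered {o l b : Type*} [Fintype o] [DecidableEq o] [Fintype l] [DecidableEq l] [Fintype b] [DecidableEq b]
    (T : o → Matrix l l ℂ) (U : Matrix (l × o) b ℂ) (V : Matrix b (l × o) ℂ) {t u v bb : ℝ}
    (hT : ∀ k, IsUnit (T k)) (ht : ∀ k, ‖(T k)⁻¹‖ ≤ t) (ht0 : 0 ≤ t) (hu : ‖U‖ ≤ u) (hv : ‖V‖ ≤ v)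
    (hS : IsUnit (capS T U V)) (hb : ‖(capS T U V)⁻¹‖ ≤ bb) :
    IsUnit (fromBlocks (blockDiagonal T) U V (0 : Matrix b b ℂ)) ∧
      ‖(fromBlocks (blockDiagonal T) U V (0 : Matrix b b ℂ))⁻¹‖ ≤ t + (t * u + 1) * bb * (v * t + 1) := by
  have hu0 : 0 ≤ u := (norm_nonneg _).trans hu
  have hv0 : 0 ≤ v := (norm_nonneg _).trans hv
  have hb0 : 0 ≤ bb := (norm_nonneg _).trans hb
  refine isUnit_and_norm_inv_le_of_apriori (by positivity) fun x => ?_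
  have hx : x = Sum.elim (x ∘ Sum.inl) (x ∘ Sum.inr) := by funext i; cases i <;> rfl
  rw [hx]
  exact apriori_bordered T U V hT ht ht0 hu hv hS hb _ _

end Summit.QuantumFields.BalabanUV.Beta.GAN24.ArrowNorms

end
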